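import Literature.NumberTheory.LFunctions.ChebyshevHalfLineBiasProgressionsRiesz
import Literature.NumberTheory.LFunctions.ChebyshevHalfLineBiasProgressionsProofs
import Literature.NumberTheory.LFunctions.ChebyshevHalfLineBiasThm8RieszProofs
import Mathlib.NumberTheory.LSeries.PrimesInAP
import HarnessLib

/-!
# A GRH-EQUIVALENT criterion PROVED as an equivalence (Suzuki 2025, Thm 6 (ii), (1.23)) — «nothing here bears on the truth of RH»
# `lim_{x→∞} [Σ_{n ≤ x, n ≡ 1 (q)} Λ(n) n^{-1/2}(1 − log n/log x) − 4√x/(φ(q) log x)] = −φ(q)^{-1} Σ_χ (L'/L)(½, χ)` ⟺ GRH for every `χ` mod `q`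

LINE 1 — LABEL: GRH-EQUIVALENT criterion (clause (ii) of Suzuki's Thm 6), PROVED AS AN EQUIVALENCE: «if» is the tree's
`ProgressionsRiesz.tendsto_progressionRieszMean_of_GRH` (`ChebyshevHalfLineBiasProgressionsRiesz.lean`); «only if» is
proved here along the printed §5.1 with the sign-free continuation engine of `ChebyshevHalfLineBiasThm8RieszProofs.lean`
(`DirichletHalfLineRiesz.entire_ne_zero_of_laplace_eq_of_integrable`, rh-lit-frontier-2) in place of Landau's theorem. bears_on:
LADDER-RH COLUMN 1 SCREW (S-C, criterion rung: the first clause of the named fact `Suzuki2025Chebyshev_thm6_limits`;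
clauses (iii)–(v) remain). WHAT THIS IS NOT: not a route, not progress toward RH or GRH — it fixes WHICH limit statement IS
the GRH for the characters mod `q`; nothing here bears on the truth of RH.

M. Suzuki, *On variants of Chebyshev's conjecture*, Ramanujan J. **68** (2025), no. 4, art. 95 = arXiv:2411.07436
[`Suzuki2025Chebyshev`; PUBLISHED, refereed], §1.3 **Theorem 6 (ii)**, AS PRINTED: «Suppose that `L(1/2, χ) ≠ 0` for all
Dirichlet character `χ` modulo `q`. Then, we have
`lim_{x→∞} [Σ_{n ≤ x, n ≡ 1 mod q} Λ(n) n^{-1/2}(1 − log n/log x) − 4√x/(φ(q) log x)] = −φ(q)^{-1} Σ_{χ mod q} (L'/L)(1/2, χ)`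
(1.23) if and only if the GRH for `L(s, χ)` holds for all Dirichlet characters `χ` modulo `q`.» Printed proof of «only if»
(§5.1 with §4.1): the limit gives `Σ_{n ≤ x, n ≡ 1 (q)} Λ(n) n^{-1/2} log(x/n) − 4√x/φ(q) ≪ log x`, so the transform (5.4),
`−(s − ½)^{-2} φ(q)^{-1} Σ_χ (L'/L)(s, χ) − 4/(φ(q)(s − 1))`, converges absolutely and is holomorphic on `Re s > ½`; it is
regular at `s = 1` (the pole of `(L'/L)(s, χ₀)` cancels), and the residues of `Σ_χ (L'/L)` at zeros are positive and cannot
cancel: `Π_χ L(s, χ) ≠ 0` on `Re s > ½`, i.e. the GRH for every `χ` (for `χ₀`, zeros of `ζ` with `Re s < ½` reflect).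

Here (Landau variable `S = s − ½`, `x = e^t`; the set-up of the tree's `Suzuki2025Chebyshev_thm6_i_holds`, whose private
plumbing — `Z₀(s) = LFunctionTrivChar₁ q s · Π_{χ ≠ χ₀} L(s, χ)` entire, `(Z₀'/Z₀)(w) = 1/(w−1) + Σ_χ (L'/L)(w, χ)`,
measurability of `φ_d`, `∫₀^∞ e^{t/2}e^{−St} dt = 1/(S − ½)` — is repeated privately):
* `forall_riemannHypothesis_of_tendsto_progressionRieszMean`: if the typed left-hand side of (1.23) converges (to ANY
  limit), then `G(t) = φ_d(t) − 4e^{t/2}/φ(q)` (`d = Λ𝟙_{n ≡ 1 (q)}`) satisfies `|G(t)| ≤ K + Ct`, hence `G e^{−σt} ∈ L¹(0, ∞)`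
  for every `σ > 0`; its transform is `(c·(Z₀'/Z₀)(½+S) + P(S))/S²` with `c = −1/φ(q)`, `P(S) = −2(2S+1)/φ(q)` for `Re S > 1`
  (Mathlib's `vonMangoldt.LSeries_residueClass_eq`, the tree's `HalfLinePrimeOnlyLandau.integral_weighted_mul_cexp`); the
  engine gives `Z₀ ≠ 0` on `Re s > ½`, whence GRH for every `χ` mod `q` (non-principal: the tree's
  `DirichletHalfLineLandau.riemannHypothesis_of_forall_ne_zero`; principal: `LFunctionTrivChar_eq_mul_riemannZeta` and
  `GeneralizedRH.riemannZeta_one_sub_eq_zero`).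
* `Suzuki2025Chebyshev_thm6_ii`: the first clause of `Suzuki2025Chebyshev_thm6_limits`, AS TYPED, as a theorem.

GRH-EQUIVALENT criterion proved as an equivalence; nothing in this file is, or is worded as, progress toward RH or GRH.
Theorems only (D-0014/D-0026); no definitions.

## References
* [Suzuki2025Chebyshev] M. Suzuki, Ramanujan J. 68 (2025) 95 = arXiv:2411.07436: §1.3 Thm 6 (ii) (1.23); §5.1 (5.1)–(5.4),
  (5.7); §4.1 (proof of Thm 8, «Conversely …»).
* [MontgomeryVaughan2007] H. L. Montgomery, R. C. Vaughan, *Multiplicative Number Theory I*, §11.3 (orthogonality,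
  `−Σ' Λ(n)χ(n)n^{-s}`), §10.1.
-/

noncomputable section

open Complex Filter Topology Set MeasureTheory ArithmeticFunction
open scoped Real LSeries.notation

namespace Literature.NumberTheory.LFunctions

namespace SuzukiProgressionsRiesz

open DirichletCharacter

variable {q : ℕ} [NeZero q]

/-! ### The entire function `Z₀(s) = (s − 1) L(s, χ₀) · Π_{χ ≠ χ₀} L(s, χ)` -/

/-- `Z₀` is entire. [folklore] -/
private theorem differentiable_Z :
    Differentiable ℂ (fun s : ℂ ↦ LFunctionTrivChar₁ q s *
      ∏ χ ∈ Finset.univ.erase (1 : DirichletCharacter ℂ q), χ.LFunction s) :=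
  (differentiable_LFunctionTrivChar₁ q).mul
    (Differentiable.fun_finsetProd fun _ hχ ↦ differentiable_LFunction (Finset.ne_of_mem_erase hχ))

/-- For `s ≠ 1`: if every `L(s, χ) ≠ 0` then `Z₀(s) ≠ 0`. [folklore] -/
private theorem Z_ne_zero_of_forall {s : ℂ} (hs : s ≠ 1)
    (h : ∀ χ : DirichletCharacter ℂ q, χ.LFunction s ≠ 0) :
    LFunctionTrivChar₁ q s * ∏ χ ∈ Finset.univ.erase (1 : DirichletCharacter ℂ q), χ.LFunction s ≠ 0 := by
  refine mul_ne_zero ?_ (Finset.prod_ne_zero_iff.2 fun χ _ ↦ h χ)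
  rw [LFunctionTrivChar₁, Function.update_of_ne hs]
  exact mul_ne_zero (sub_ne_zero.2 hs) (h 1)

/-- For `s ≠ 1`: `Z₀(s) ≠ 0` gives `L(s, χ) ≠ 0` for every `χ`. [folklore] -/
private theorem ne_zero_of_Z {s : ℂ} (hs : s ≠ 1)
    (h : LFunctionTrivChar₁ q s * ∏ χ ∈ Finset.univ.erase (1 : DirichletCharacter ℂ q), χ.LFunction s ≠ 0)
    (χ : DirichletCharacter ℂ q) : χ.LFunction s ≠ 0 := by
  rcases eq_or_ne χ 1 with rfl | hχ
  · have h1 := left_ne_zero_of_mul h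
    rw [LFunctionTrivChar₁, Function.update_of_ne hs] at h1
    exact right_ne_zero_of_mul h1
  · exact (Finset.prod_ne_zero_iff.1 (right_ne_zero_of_mul h)) χ (Finset.mem_erase.2 ⟨hχ, Finset.mem_univ _⟩)

/-- `Z₀ ≠ 0` on `Re s ≥ 1`. [folklore] -/
private theorem Z_ne_zero_of_one_le_re {s : ℂ} (hs : 1 ≤ s.re) :
    LFunctionTrivChar₁ q s * ∏ χ ∈ Finset.univ.erase (1 : DirichletCharacter ℂ q), χ.LFunction s ≠ 0 := by
  rcases eq_or_ne s 1 with rfl | hs1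
  · refine mul_ne_zero (LFunctionTrivChar₁_apply_one_ne_zero q) (Finset.prod_ne_zero_iff.2 fun χ hχ ↦ ?_)
    exact LFunction_ne_zero_of_one_le_re χ (Or.inl (Finset.ne_of_mem_erase hχ)) hs
  · exact Z_ne_zero_of_forall hs1 fun χ ↦ LFunction_ne_zero_of_one_le_re χ (Or.inr hs1) hs

/-- For `Re w > 1`: `(Z₀'/Z₀)(w) = 1/(w − 1) + Σ_χ (L'/L)(w, χ)`. [folklore] -/
private theorem logDeriv_Z {w : ℂ} (hw : 1 < w.re) :
    logDeriv (fun s : ℂ ↦ LFunctionTrivChar₁ q s *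
      ∏ χ ∈ Finset.univ.erase (1 : DirichletCharacter ℂ q), χ.LFunction s) w =
      1 / (w - 1) + ∑ χ : DirichletCharacter ℂ q, logDeriv χ.LFunction w := by
  have hw1 : w ≠ 1 := fun h ↦ by rw [h, one_re] at hw; exact lt_irrefl _ hw
  have hL : ∀ χ : DirichletCharacter ℂ q, χ.LFunction w ≠ 0 := fun χ ↦
    LFunction_ne_zero_of_one_le_re χ (Or.inr hw1) hw.le
  have hdχ : ∀ χ ∈ Finset.univ.erase (1 : DirichletCharacter ℂ q), DifferentiableAt ℂ χ.LFunction w :=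
    fun χ hχ ↦ differentiable_LFunction (Finset.ne_of_mem_erase hχ) w
  have hd1 : DifferentiableAt ℂ (1 : DirichletCharacter ℂ q).LFunction w :=
    differentiableAt_LFunction _ w (Or.inl hw1)
  -- the first factor agrees with `(s − 1) L(s, χ₀)` near `w`
  have hev : LFunctionTrivChar₁ q =ᶠ[𝓝 w] fun s ↦ (s - 1) * (1 : DirichletCharacter ℂ q).LFunction s := by
    filter_upwards [isOpen_ne.mem_nhds hw1] with s hs
    rw [LFunctionTrivChar₁, Function.update_of_ne hs]
  have hA0 : LFunctionTrivChar₁ q w ≠ 0 := by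
    rw [hev.eq_of_nhds]
    exact mul_ne_zero (sub_ne_zero.2 hw1) (hL 1)
  have hA : logDeriv (LFunctionTrivChar₁ q) w = 1 / (w - 1) + logDeriv (1 : DirichletCharacter ℂ q).LFunction w := by
    have h1 : logDeriv (LFunctionTrivChar₁ q) w =
        logDeriv (fun s ↦ (s - 1) * (1 : DirichletCharacter ℂ q).LFunction s) w := by
      rw [logDeriv_apply, logDeriv_apply, hev.deriv_eq, hev.eq_of_nhds]
    rw [h1, logDeriv_mul (f := fun s : ℂ ↦ s - 1) (g := (1 : DirichletCharacter ℂ q).LFunction) w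
      (sub_ne_zero.2 hw1) (hL 1) (by fun_prop) hd1]
    congr 1
    rw [logDeriv_apply, deriv_sub_const, deriv_id'', one_div]
  have hB0 : ∏ χ ∈ Finset.univ.erase (1 : DirichletCharacter ℂ q), χ.LFunction w ≠ 0 :=
    Finset.prod_ne_zero_iff.2 fun χ _ ↦ hL χ
  have hdB : DifferentiableAt ℂ
      (fun s : ℂ ↦ ∏ χ ∈ Finset.univ.erase (1 : DirichletCharacter ℂ q), χ.LFunction s) w :=
    DifferentiableAt.fun_finsetProd hdχ
  rw [logDeriv_mul (f := LFunctionTrivChar₁ q)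
      (g := fun s : ℂ ↦ ∏ χ ∈ Finset.univ.erase (1 : DirichletCharacter ℂ q), χ.LFunction s) w hA0 hB0
      ((differentiable_LFunctionTrivChar₁ q) w) hdB, hA,
    logDeriv_prod (s := Finset.univ.erase (1 : DirichletCharacter ℂ q)) (f := fun χ ↦ χ.LFunction) (x := w)
      (fun χ _ ↦ hL χ) hdχ, add_assoc,
    Finset.add_sum_erase Finset.univ (fun χ : DirichletCharacter ℂ q ↦ logDeriv χ.LFunction w) (Finset.mem_univ _)]


/-! ### The weighted counting function and the transform of `e^{t/2}` -/

/-! ### The one-signed functions and their transforms -/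

/-- `A_d(t) = Σ_{n ≤ e^t} d(n)/√n` is monotone for `d ≥ 0`. [folklore] -/
private theorem monotone_count {d : ℕ → ℝ} (hd0 : ∀ n, 0 ≤ d n) :
    Monotone fun t : ℝ ↦ ∑ n ∈ Finset.Icc 1 ⌊Real.exp t⌋₊, d n / Real.sqrt n := by
  intro t u htu
  refine Finset.sum_le_sum_of_subset_of_nonneg
    (Finset.Icc_subset_Icc_right (Nat.floor_mono (Real.exp_le_exp.2 htu))) fun n _ _ ↦ ?_
  exact div_nonneg (hd0 n) (Real.sqrt_nonneg _)

/-- `B_d(t) = Σ_{n ≤ e^t} d(n) log n/√n` is monotone for `d ≥ 0`. [folklore] -/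
private theorem monotone_countLog {d : ℕ → ℝ} (hd0 : ∀ n, 0 ≤ d n) :
    Monotone fun t : ℝ ↦ ∑ n ∈ Finset.Icc 1 ⌊Real.exp t⌋₊, d n / Real.sqrt n * Real.log n := by
  intro t u htu
  refine Finset.sum_le_sum_of_subset_of_nonneg
    (Finset.Icc_subset_Icc_right (Nat.floor_mono (Real.exp_le_exp.2 htu))) fun n _ _ ↦ ?_
  exact mul_nonneg (div_nonneg (hd0 n) (Real.sqrt_nonneg _)) (Real.log_natCast_nonneg n)

/-- `φ_d(t) = Σ_{n ≤ e^t} d(n)/√n (t − log n) = t A_d(t) − B_d(t)` is measurable. [folklore] -/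
private theorem measurable_weighted {d : ℕ → ℝ} (hd0 : ∀ n, 0 ≤ d n) :
    Measurable fun t : ℝ ↦ ∑ n ∈ Finset.Icc 1 ⌊Real.exp t⌋₊, d n / Real.sqrt n * (t - Real.log n) := by
  have h : (fun t : ℝ ↦ ∑ n ∈ Finset.Icc 1 ⌊Real.exp t⌋₊, d n / Real.sqrt n * (t - Real.log n)) =
      fun t ↦ t * (∑ n ∈ Finset.Icc 1 ⌊Real.exp t⌋₊, d n / Real.sqrt n)
        - ∑ n ∈ Finset.Icc 1 ⌊Real.exp t⌋₊, d n / Real.sqrt n * Real.log n := by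
    funext t
    rw [Finset.mul_sum, ← Finset.sum_sub_distrib]
    refine Finset.sum_congr rfl fun n _ ↦ ?_
    ring
  rw [h]
  exact (measurable_id.mul (monotone_count hd0).measurable).sub (monotone_countLog hd0).measurable

/-- `∫₀^∞ e^{t/2} e^{−St} dt = 1/(S − 1/2)` for `Re S > 1/2`, with integrability. [folklore] -/
private theorem integral_exp_half_mul_cexp {s : ℂ} (hs : 1 / 2 < s.re) :
    IntegrableOn (fun t : ℝ ↦ ((Real.exp (t / 2) : ℝ) : ℂ) * cexp (-s * t)) (Ioi 0) ∧
      ∫ t in Ioi (0 : ℝ), ((Real.exp (t / 2) : ℝ) : ℂ) * cexp (-s * t) = 1 / (s - 1 / 2) := by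
  have ha : ((1 / 2 : ℂ) - s).re < 0 := by simp; linarith
  have hne : (1 / 2 : ℂ) - s ≠ 0 := fun h ↦ by rw [h, zero_re] at ha; exact lt_irrefl _ ha
  have hne' : s - 1 / 2 ≠ 0 := fun h ↦ hne (by rw [← neg_sub, h, neg_zero])
  have heq : ∀ t : ℝ, ((Real.exp (t / 2) : ℝ) : ℂ) * cexp (-s * t) = cexp (((1 / 2 : ℂ) - s) * t) := by
    intro t
    rw [Complex.ofReal_exp, ← Complex.exp_add]
    congr 1
    push_cast
    ring
  simp_rw [heq]
  refine ⟨integrableOn_exp_mul_complex_Ioi ha 0, ?_⟩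
  rw [integral_exp_mul_complex_Ioi ha 0, Complex.ofReal_zero, mul_zero, Complex.exp_zero,
    show (1 / 2 : ℂ) - s = -(s - 1 / 2) by ring, div_neg, neg_div, neg_neg]

omit [NeZero q] in
/-- The sum (1.21)/(1.22) over `n ≡ 1 (mod q)` as a sum of `d = Λ𝟙_{n ≡ 1 (q)}` over all `n ≤ y`, at `x = e^τ`:
`Σ_{n ≤ y, n ≡ 1} Λ(n)/√n · log(e^τ/n) = Σ_{n ≤ y} d(n)/√n (τ − log n)`. [folklore] -/
private theorem sum_filter_eq_sum_residueClass (τ : ℝ) (N : ℕ) :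
    ∑ n ∈ (Finset.Icc 1 N).filter (fun n : ℕ ↦ (n : ZMod q) = 1),
        Λ n / Real.sqrt n * Real.log (Real.exp τ / n) =
      ∑ n ∈ Finset.Icc 1 N, vonMangoldt.residueClass (1 : ZMod q) n / Real.sqrt n * (τ - Real.log n) := by
  rw [Finset.sum_filter]
  refine Finset.sum_congr rfl fun n hn ↦ ?_
  rw [Finset.mem_Icc] at hn
  have hn0 : (0 : ℝ) < n := by exact_mod_cast hn.1
  simp only [vonMangoldt.residueClass, Set.indicator_apply, Set.mem_setOf_eq]
  split_ifs
  · rw [Real.log_div (Real.exp_pos τ).ne' hn0.ne', Real.log_exp]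
  · simp

/-! ### Integrability from a linear bound -/

/-- If `G` is measurable and `|G(t)| ≤ K + Ct` for `t > 0`, then `G(t)e^{−σt} ∈ L¹(0, ∞)` for every `σ > 0`. [folklore] -/
private theorem integrableOn_of_linear_bound {G : ℝ → ℝ} (hG : Measurable G) {K C : ℝ}
    (hb : ∀ t : ℝ, 0 < t → |G t| ≤ K + C * t) {σ : ℝ} (hσ : 0 < σ) :
    IntegrableOn (fun t : ℝ ↦ G t * Real.exp (-σ * t)) (Ioi 0) := by
  have hσ2 : 0 < σ / 2 := by linarith
  have hmaj : IntegrableOn (fun t : ℝ ↦ (|K| + |C| * (2 / σ)) * Real.exp (-(σ / 2) * t)) (Ioi 0) :=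
    (exp_neg_integrableOn_Ioi 0 hσ2).const_mul _
  refine hmaj.mono' ((hG.mul (by fun_prop)).aestronglyMeasurable) ?_
  refine (ae_restrict_iff' measurableSet_Ioi).2 (Eventually.of_forall fun t (ht : 0 < t) ↦ ?_)
  have h1 : |G t| ≤ |K| + |C| * t := by
    refine le_trans (hb t ht) ?_
    gcongr
    · exact le_abs_self K
    · exact le_abs_self C
  have h2 : t ≤ 2 / σ * Real.exp (σ / 2 * t) := by
    have h3 := Real.add_one_le_exp (σ / 2 * t)
    rw [div_mul_eq_mul_div, le_div_iff₀ hσ]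
    nlinarith
  have h4 : Real.exp (-σ * t) ≤ Real.exp (-(σ / 2) * t) := Real.exp_le_exp.2 (by nlinarith)
  have hexp : Real.exp (σ / 2 * t) * Real.exp (-σ * t) = Real.exp (-(σ / 2) * t) := by
    rw [← Real.exp_add]
    congr 1
    ring
  rw [Real.norm_eq_abs, abs_mul, Real.abs_exp]
  calc |G t| * Real.exp (-σ * t) ≤ (|K| + |C| * t) * Real.exp (-σ * t) :=
        mul_le_mul_of_nonneg_right h1 (Real.exp_pos _).le
    _ ≤ (|K| + |C| * (2 / σ * Real.exp (σ / 2 * t))) * Real.exp (-σ * t) := by gcongr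
    _ = |K| * Real.exp (-σ * t) + |C| * (2 / σ) * Real.exp (-(σ / 2) * t) := by
        rw [← hexp]; ring
    _ ≤ |K| * Real.exp (-(σ / 2) * t) + |C| * (2 / σ) * Real.exp (-(σ / 2) * t) := by gcongr
    _ = (|K| + |C| * (2 / σ)) * Real.exp (-(σ / 2) * t) := by ring

/-! ### The limit (1.23) forces GRH for every character mod `q` -/

/-- **Suzuki 2025, Thm 6 (ii), (1.23) ⟹ GRH for every `χ` mod `q`, PROVED for every limit value**: if
`Σ_{n ≤ x, n ≡ 1 (q)} Λ(n) n^{-1/2}(1 − log n/log x) − 4√x/(φ(q) log x)` converges as `x → ∞` (to anything), then the GRH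
holds for `L(s, χ)` for every Dirichlet character `χ` mod `q`. The printed §5.1 argument with absolute convergence in place
of Landau's theorem (module docstring). [cite: Suzuki2025Chebyshev, §1.3 Thm 6 (ii) ((1.23) ⟹ GRH) and §5.1 (5.4)] -/
theorem forall_riemannHypothesis_of_tendsto_progressionRieszMean {ℓ : ℂ}
    (h : Tendsto (fun x : ℝ ↦ (((∑ n ∈ (Finset.Icc 1 ⌊x⌋₊).filter (fun n : ℕ ↦ (n : ZMod q) = 1),
          Λ n / Real.sqrt n * (1 - Real.log n / Real.log x))
        - 4 * Real.sqrt x / (Nat.totient q * Real.log x) : ℝ) : ℂ)) atTop (𝓝 ℓ)) :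
    ∀ χ : DirichletCharacter ℂ q, χ.RiemannHypothesis := by
  have hφ0 : (q.totient : ℂ) ≠ 0 := by exact_mod_cast (Nat.totient_pos.mpr (NeZero.pos q)).ne'
  have hφpos : (0 : ℝ) < q.totient := by exact_mod_cast Nat.totient_pos.mpr (NeZero.pos q)
  -- the real limit
  set F : ℝ → ℝ := fun x ↦ (∑ n ∈ (Finset.Icc 1 ⌊x⌋₊).filter (fun n : ℕ ↦ (n : ZMod q) = 1),
      Λ n / Real.sqrt n * (1 - Real.log n / Real.log x)) - 4 * Real.sqrt x / (Nat.totient q * Real.log x) with hF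
  have hre : Tendsto F atTop (𝓝 ℓ.re) := by
    have h1 := (Complex.continuous_re.tendsto ℓ).comp h
    have h2 : (fun x ↦ ((F x : ℝ) : ℂ).re) = F := funext fun x ↦ Complex.ofReal_re _
    rw [show (Complex.re ∘ fun x : ℝ ↦ ((F x : ℝ) : ℂ)) = F from h2] at h1
    exact h1
  obtain ⟨x₁, hx₁⟩ := Filter.eventually_atTop.1 (Metric.tendsto_nhds.1 hre 1 one_pos)
  -- the coefficients `d = Λ𝟙_{n ≡ 1 (q)} ∈ [0, Λ]`
  set d : ℕ → ℝ := vonMangoldt.residueClass (1 : ZMod q) with hd_def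
  have hd0 : ∀ n, 0 ≤ d n := vonMangoldt.residueClass_nonneg _
  have hdle : ∀ n, d n ≤ Λ n := vonMangoldt.residueClass_le _
  -- `Z₀`
  set Z₀ : ℂ → ℂ := fun s : ℂ ↦ LFunctionTrivChar₁ q s *
    ∏ χ ∈ Finset.univ.erase (1 : DirichletCharacter ℂ q), χ.LFunction s with hZ₀_def
  have hZ₀d : Differentiable ℂ Z₀ := differentiable_Z
  have hZ₀right : ∀ s : ℂ, 1 ≤ s.re → Z₀ s ≠ 0 := fun s hs ↦ Z_ne_zero_of_one_le_re hs
  have hLd : ∀ s : ℂ, 1 < s.re →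
      L (fun n ↦ (d n : ℂ)) (1 / 2 + s) = -(q.totient : ℂ)⁻¹ * (logDeriv Z₀ (1 / 2 + s) - 1 / (s - 1 / 2)) := by
    intro s hs
    have hw : 1 < (1 / 2 + s : ℂ).re := by simp; linarith
    rw [hd_def, SuzukiProgressions.LSeries_residueClass_one hw, hZ₀_def, logDeriv_Z hw]
    congr 1
    rw [show (1 / 2 : ℂ) + s - 1 = s - 1 / 2 by ring]
    ring
  -- `G(t) = φ_d(t) − 4 e^{t/2}/φ(q)`
  set G : ℝ → ℝ := fun t ↦
    (∑ n ∈ Finset.Icc 1 ⌊Real.exp t⌋₊, d n / Real.sqrt n * (t - Real.log n))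
      - 4 * Real.exp (t / 2) / Nat.totient q with hG_def
  have hGm : Measurable G := (measurable_weighted hd0).sub (by fun_prop)
  -- `G(t) = t · F(e^t)` for `t ≠ 0`
  have hGF : ∀ t : ℝ, t ≠ 0 → G t = t * F (Real.exp t) := by
    intro t ht
    rw [hG_def, hF]
    simp only
    rw [Real.log_exp, ← Real.exp_half, mul_sub, ← sum_filter_eq_sum_residueClass, Finset.mul_sum]
    congr 1
    · refine Finset.sum_congr rfl fun n hn ↦ ?_
      have hn1 : 1 ≤ n := (Finset.mem_Icc.1 (Finset.mem_filter.1 hn).1).1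
      have hn0 : (0 : ℝ) < n := by exact_mod_cast hn1
      rw [Real.log_div (Real.exp_pos t).ne' hn0.ne', Real.log_exp]
      field_simp
    · field_simp
  -- the linear bound `|G t| ≤ K + C t`
  set t₁ : ℝ := max (Real.log (max x₁ 1)) 1 with ht₁
  have ht₁1 : 1 ≤ t₁ := le_max_right _ _
  set K : ℝ := t₁ * (∑ n ∈ Finset.Icc 1 ⌊Real.exp t₁⌋₊, Λ n / Real.sqrt n) +
    4 * Real.exp (t₁ / 2) / Nat.totient q with hK
  set C : ℝ := |ℓ.re| + 1 with hC
  have hsum0 : ∀ t : ℝ, 0 ≤ ∑ n ∈ Finset.Icc 1 ⌊Real.exp t⌋₊, Λ n / Real.sqrt n := fun t ↦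
    Finset.sum_nonneg fun n _ ↦ div_nonneg vonMangoldt_nonneg (Real.sqrt_nonneg _)
  have hK0 : 0 ≤ K := by
    have : 0 ≤ 4 * Real.exp (t₁ / 2) / Nat.totient q := by positivity
    have := hsum0 t₁
    positivity
  have hbound : ∀ t : ℝ, 0 < t → |G t| ≤ K + C * t := by
    intro t ht
    rcases le_or_gt t t₁ with hle | hgt
    · -- `0 < t ≤ t₁`: `0 ≤ φ_d(t) ≤ t₁ Σ_{n ≤ e^{t₁}} Λ/√n`
      have hφle : |∑ n ∈ Finset.Icc 1 ⌊Real.exp t⌋₊, d n / Real.sqrt n * (t - Real.log n)| ≤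
          t₁ * ∑ n ∈ Finset.Icc 1 ⌊Real.exp t₁⌋₊, Λ n / Real.sqrt n := by
        have hterm : ∀ n ∈ Finset.Icc 1 ⌊Real.exp t⌋₊,
            0 ≤ d n / Real.sqrt n * (t - Real.log n) ∧
              d n / Real.sqrt n * (t - Real.log n) ≤ t₁ * (Λ n / Real.sqrt n) := by
          intro n hn
          rw [Finset.mem_Icc] at hn
          have hn0 : (0 : ℝ) < n := by exact_mod_cast hn.1
          have hnt : Real.log n ≤ t := by
            have h1 : (n : ℝ) ≤ Real.exp t := le_trans (by exact_mod_cast hn.2) (Nat.floor_le (Real.exp_pos t).le)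
            have := Real.log_le_log hn0 h1
            rwa [Real.log_exp] at this
          have hl0 : 0 ≤ t - Real.log n := by linarith
          have hdn : 0 ≤ d n / Real.sqrt n := div_nonneg (hd0 n) (Real.sqrt_nonneg _)
          refine ⟨mul_nonneg hdn hl0, ?_⟩
          calc d n / Real.sqrt n * (t - Real.log n) ≤ Λ n / Real.sqrt n * t₁ := by
                apply mul_le_mul (div_le_div_of_nonneg_right (hdle n) (Real.sqrt_nonneg _)) _ hl0
                  (div_nonneg vonMangoldt_nonneg (Real.sqrt_nonneg _))
                linarith [Real.log_natCast_nonneg n]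
            _ = t₁ * (Λ n / Real.sqrt n) := mul_comm _ _
        rw [abs_of_nonneg (Finset.sum_nonneg fun n hn ↦ (hterm n hn).1), Finset.mul_sum]
        calc ∑ n ∈ Finset.Icc 1 ⌊Real.exp t⌋₊, d n / Real.sqrt n * (t - Real.log n)
            ≤ ∑ n ∈ Finset.Icc 1 ⌊Real.exp t⌋₊, t₁ * (Λ n / Real.sqrt n) := Finset.sum_le_sum fun n hn ↦ (hterm n hn).2
          _ ≤ ∑ n ∈ Finset.Icc 1 ⌊Real.exp t₁⌋₊, t₁ * (Λ n / Real.sqrt n) := by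
              apply Finset.sum_le_sum_of_subset_of_nonneg
                (Finset.Icc_subset_Icc_right (Nat.floor_mono (Real.exp_le_exp.2 hle)))
              intro n _ _
              exact mul_nonneg (by linarith) (div_nonneg vonMangoldt_nonneg (Real.sqrt_nonneg _))
      have hE : |4 * Real.exp (t / 2) / Nat.totient q| ≤ 4 * Real.exp (t₁ / 2) / Nat.totient q := by
        rw [abs_of_nonneg (by positivity)]
        gcongr
      calc |G t| ≤ |∑ n ∈ Finset.Icc 1 ⌊Real.exp t⌋₊, d n / Real.sqrt n * (t - Real.log n)| +
            |4 * Real.exp (t / 2) / Nat.totient q| := abs_sub _ _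
        _ ≤ K := by rw [hK]; exact add_le_add hφle hE
        _ ≤ K + C * t := by
            have : 0 ≤ C * t := mul_nonneg (by positivity) ht.le
            linarith
    · -- `t > t₁`: `e^t ≥ x₁`, so `|F(e^t)| ≤ C` and `G(t) = t F(e^t)`
      have hxt : x₁ ≤ Real.exp t := by
        have h1 : Real.log (max x₁ 1) < t := lt_of_le_of_lt (le_max_left _ _) hgt
        have h2 : max x₁ 1 < Real.exp t := by
          rw [← Real.exp_log (lt_of_lt_of_le one_pos (le_max_right x₁ 1))]
          exact Real.exp_lt_exp.2 h1
        exact le_trans (le_max_left _ _) h2.le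
      have hFt : |F (Real.exp t)| ≤ C := by
        have hd1 := hx₁ (Real.exp t) hxt
        rw [Real.dist_eq] at hd1
        have := abs_sub_abs_le_abs_sub (F (Real.exp t)) ℓ.re
        rw [hC]
        linarith
      rw [hGF t (by linarith), abs_mul, abs_of_pos ht]
      calc t * |F (Real.exp t)| ≤ t * C := mul_le_mul_of_nonneg_left hFt ht.le
        _ ≤ K + C * t := by linarith
  -- the engine: `Z₀ ≠ 0` on `Re s > ½`
  have hZ : ∀ s : ℂ, 1 / 2 < s.re → Z₀ s ≠ 0 := by
    refine DirichletHalfLineRiesz.entire_ne_zero_of_laplace_eq_of_integrable hZ₀d hZ₀right hGm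
      (fun σ hσ ↦ integrableOn_of_linear_bound hGm hbound hσ)
      (c := fun _ ↦ -(q.totient : ℂ)⁻¹) (P := fun s ↦ -2 * (q.totient : ℂ)⁻¹ * (2 * s + 1))
      (by fun_prop) (fun _ _ _ ↦ neg_ne_zero.2 (inv_ne_zero hφ0)) (by fun_prop) (fun s hs ↦ ?_)
    have ha : (-s).re < -1 / 2 := by simp; linarith
    have hs' : 1 / 2 < s.re := by linarith
    obtain ⟨hi₁, hI₁⟩ := HalfLinePrimeOnlyLandau.integral_weighted_mul_cexp (d := d) hd0 hdle ha
    obtain ⟨hi₂, hI₂⟩ := integral_exp_half_mul_cexp hs'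
    have heq : EqOn (fun t : ℝ ↦ (G t : ℂ) * cexp (-s * t))
        (fun t ↦ ((∑ n ∈ Finset.Icc 1 ⌊Real.exp t⌋₊, d n / Real.sqrt n * (t - Real.log n) : ℝ) : ℂ) *
              cexp (-s * t)
            - (4 / (q.totient : ℂ)) * (((Real.exp (t / 2) : ℝ) : ℂ) * cexp (-s * t))) (Ioi 0) := by
      intro t _
      simp only [hG_def]
      push_cast
      ring
    rw [setIntegral_congr_fun measurableSet_Ioi heq, integral_sub hi₁ (hi₂.const_mul _),
      integral_const_mul, hI₁, hI₂, show (1 / 2 : ℂ) - -s = 1 / 2 + s by ring, hLd s hs]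
    have hs0 : s ≠ 0 := fun h ↦ by rw [h, zero_re] at hs; linarith
    have hs2 : s - 1 / 2 ≠ 0 := fun h ↦ by
      have := congrArg re h
      simp at this
      linarith
    have hs3 : (-1 + s * 2 : ℂ) ≠ 0 := fun h ↦ hs2 (by linear_combination h / 2)
    have hs4 : (2 * s - 1 : ℂ) ≠ 0 := fun h ↦ hs2 (by linear_combination h / 2)
    have hs5 : (s * 2 - 1 : ℂ) ≠ 0 := fun h ↦ hs2 (by linear_combination h / 2)
    have hs6 : (1 - s * 2 : ℂ) ≠ 0 := fun h ↦ hs2 (by linear_combination -h / 2)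
    have hs7 : (1 - 2 * s : ℂ) ≠ 0 := fun h ↦ hs2 (by linear_combination -h / 2)
    rw [show (1 : ℂ) / (s - 1 / 2) = 2 / (2 * s - 1) by rw [div_eq_div_iff hs2 hs4]; ring]
    field_simp
    ring
  -- `L(s, χ) ≠ 0` for `½ < Re s`, `s ≠ 1`, every `χ`
  have hmain : ∀ χ : DirichletCharacter ℂ q, ∀ s : ℂ, 1 / 2 < s.re → s ≠ 1 → χ.LFunction s ≠ 0 :=
    fun χ s hs hs1 ↦ ne_zero_of_Z hs1 (hZ s hs) χ
  intro χ
  rcases ne_or_eq χ 1 with hχ | rfl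
  · refine DirichletHalfLineLandau.riemannHypothesis_of_forall_ne_zero hχ fun s hs ↦ ?_
    rcases eq_or_ne s 1 with rfl | hs1
    · exact LFunction_ne_zero_of_one_le_re χ (Or.inl hχ) (by simp)
    · exact hmain χ s hs hs1
  · -- the principal character: `L(s, χ₀) = Π_{p ∣ q}(1 − p^{-s}) ζ(s)`, reflect a zero with `Re s < 1/2`
    intro s h0 h0re h1re
    by_contra hne
    have hs1 : s ≠ 1 := fun h ↦ by rw [h, one_re] at h1re; exact lt_irrefl _ h1re
    rcases lt_or_gt_of_ne hne with hlt | hgt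
    · have hs0 : s ≠ 0 := fun h ↦ by rw [h, zero_re] at h0re; exact lt_irrefl _ h0re
      have heuler : ∀ w : ℂ, 0 < w.re → ∏ p ∈ q.primeFactors, (1 - (p : ℂ) ^ (-w)) ≠ 0 := by
        intro w hw
        refine Finset.prod_ne_zero_iff.2 fun p hp hzero ↦ ?_
        have hp := Nat.prime_of_mem_primeFactors hp
        have h1 : (p : ℂ) ^ (-w) = 1 := (sub_eq_zero.1 hzero).symm
        have hn : ‖(p : ℂ) ^ (-w)‖ = (p : ℝ) ^ (-w).re := Complex.norm_natCast_cpow_of_pos hp.pos _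
        rw [h1, norm_one] at hn
        have hlt : (p : ℝ) ^ (-w).re < 1 :=
          Real.rpow_lt_one_of_one_lt_of_neg (by exact_mod_cast hp.one_lt) (by simp; exact hw)
        linarith
      have hζ : riemannZeta s = 0 := by
        have h0' : LFunctionTrivChar q s = 0 := h0
        rw [LFunctionTrivChar_eq_mul_riemannZeta hs1, mul_eq_zero] at h0'
        exact h0'.resolve_left (heuler s h0re)
      have hζ' := GeneralizedRH.riemannZeta_one_sub_eq_zero hζ h0re h1re
      have h1s : (1 - s) ≠ 1 := fun h ↦ hs0 (by linear_combination -h)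
      have hL : LFunctionTrivChar q (1 - s) = 0 := by
        rw [LFunctionTrivChar_eq_mul_riemannZeta h1s, hζ', mul_zero]
      exact hmain 1 (1 - s) (by simp; linarith) h1s hL
    · exact hmain 1 s hgt hs1 h0

end SuzukiProgressionsRiesz

/-! ## Theorem 6 (ii) as an equivalence -/

/-- **Suzuki 2025, Theorem 6 (ii), PROVED** (the first clause of the named fact `Suzuki2025Chebyshev_thm6_limits`, AS TYPED
there): if `L(½, χ) ≠ 0` for every `χ` mod `q`, then
`lim_{x→∞} [Σ_{n ≤ x, n ≡ 1 (q)} Λ(n) n^{-1/2}(1 − log n/log x) − 4√x/(φ(q) log x)] = −φ(q)^{-1} Σ_χ (L'/L)(½, χ)` holds if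
and only if the GRH holds for `L(s, χ)` for every Dirichlet character `χ` mod `q`. «If»: the tree's
`ProgressionsRiesz.tendsto_progressionRieszMean_of_GRH`; «only if»: `forall_riemannHypothesis_of_tendsto_progressionRieszMean`.
A GRH-EQUIVALENT criterion proved as an equivalence; nothing here bears on the truth of RH.
[cite: Suzuki2025Chebyshev, §1.3 Thm 6 (ii) (1.23)] -/
theorem Suzuki2025Chebyshev_thm6_ii {q : ℕ} [NeZero q]
    (hL : ∀ χ : DirichletCharacter ℂ q, χ.LFunction (1 / 2) ≠ 0) :
    Tendsto (fun x : ℝ ↦ (((∑ n ∈ (Finset.Icc 1 ⌊x⌋₊).filter (fun n : ℕ ↦ (n : ZMod q) = 1),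
          Λ n / Real.sqrt n * (1 - Real.log n / Real.log x))
        - 4 * Real.sqrt x / (Nat.totient q * Real.log x) : ℝ) : ℂ)) atTop
      (𝓝 (-(1 / (Nat.totient q : ℂ)) * ∑ χ : DirichletCharacter ℂ q, logDeriv χ.LFunction (1 / 2))) ↔
      ∀ χ : DirichletCharacter ℂ q, χ.RiemannHypothesis :=
  ⟨fun h ↦ SuzukiProgressionsRiesz.forall_riemannHypothesis_of_tendsto_progressionRieszMean h,
    fun h ↦ ProgressionsRiesz.tendsto_progressionRieszMean_of_GRH hL h⟩

end Literature.NumberTheory.LFunctions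

end
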